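import Literature.AlgebraicGeometry.Resolution.QuadraticTransformsStructure

/-!
# One quadratic transform seen from a divisor through the new centre: the key step

Helper file for the stub `stub_curveMonomialization` of the line `pfaff-line-log-final-forms`
(crux `Valuative.LuAlphaPTorsor`, item `stmt-ResolutionOfSingularities-0641`): embedded
resolution of a plane curve germ along a valuation by quadratic transforms (Zariski; Abhyankar
1956; Huneke–Swanson Ch. 14).

Let `R → R₁` be the quadratic transform of the two-dimensional regular local ring `R ⊆ K` along a
valuation ring `O` dominating `R`. PROVED:

* `exists_maximalIdeal_eq_span_pair_of_step` — `𝔪_{R₁} = (x, f)` with `x ∈ 𝔪_R` the chart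
  element (the exceptional curve `x = 0` passes through the new centre and is part of a regular
  system of parameters there; Huneke–Swanson p. 264);
* `key_step` — **the key step**: if `𝔪_R = (u, v)` and a valuation ring `W ⊇ R₁` has `w(u) > 0`,
  `w(v) = 0` (the curve `u = 0`, regular at the centre of `R`, still passes through the centre of
  `R₁`), then `R₁` lies in the chart `R[u/v]` and `𝔪_{R₁} = (v, u/v)`: the strict transform
  `u/v = 0` of the curve and the exceptional curve `v = 0` cross normally at the new centre;
* `not_mem_sq_of_span_pair` — a member of a two-element generating set of the maximal ideal of a
  two-dimensional regular local ring lies outside `𝔪²`.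

All [folklore] (Zariski–Samuel II, App. 5; Huneke–Swanson 2006, §14.2).
-/

set_option linter.dupNamespace false

namespace Summit.ResolutionOfSingularities.ResolutionOfSingularities.Theorems.PfaffLine.CurveMono

open IsLocalRing Polynomial Literature.AlgebraicGeometry.Resolution

variable {K : Type} [Field K]

/-! ## Maximal ideals of local subrings of `K` described inside `K` -/

/-- If every non-unit `z` of the local subring `S ⊆ K` is an `S`-combination `a p + c q` of two
non-units `p, q ∈ S`, then `𝔪_S = (p, q)`. [folklore] -/
theorem maximalIdeal_eq_span_pair_of_forall {S : Subring K} [IsLocalRing S] {p q : K}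
    (hp : p ∈ S) (hq : q ∈ S) (hpS : p = 0 ∨ p⁻¹ ∉ S) (hqS : q = 0 ∨ q⁻¹ ∉ S)
    (H : ∀ z ∈ S, (z = 0 ∨ z⁻¹ ∉ S) → ∃ a ∈ S, ∃ c ∈ S, z = a * p + c * q) :
    maximalIdeal S = Ideal.span {⟨p, hp⟩, ⟨q, hq⟩} := by
  apply le_antisymm
  · intro z hz
    obtain ⟨a, ha, c, hc, e⟩ := H z z.2 ((mem_maximalIdeal_iff_inv_not_mem z).mp hz)
    rw [Ideal.mem_span_pair]
    refine ⟨⟨a, ha⟩, ⟨c, hc⟩, Subtype.ext ?_⟩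
    rw [Subring.coe_add, Subring.coe_mul, Subring.coe_mul]
    exact e.symm
  · rw [Ideal.span_le]
    rintro _ (rfl | rfl)
    · exact (mem_maximalIdeal_iff_inv_not_mem _).mpr hpS
    · exact (mem_maximalIdeal_iff_inv_not_mem _).mpr hqS

/-- In the local ring `L = A_Q ⊆ K` of a subring `A` at a prime `Q = (p, q)`, every non-unit is
an `L`-combination of `p` and `q` (`𝔪_L = Q L`). [folklore] -/
theorem exists_eq_comb_of_ofPrime {A : Subring K} {Q : Ideal A} [Q.IsPrime] {p q : A}
    (hQ : Q = Ideal.span {p, q}) {z : K} (hz : z ∈ (LocalSubring.ofPrime A Q).toSubring)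
    (hzS : z = 0 ∨ z⁻¹ ∉ (LocalSubring.ofPrime A Q).toSubring) :
    ∃ a ∈ (LocalSubring.ofPrime A Q).toSubring, ∃ c ∈ (LocalSubring.ofPrime A Q).toSubring,
      z = a * p + c * q := by
  set L := (LocalSubring.ofPrime A Q).toSubring with hL
  have halg : ∀ y : A, ((algebraMap A L y : L) : K) = y := fun _ => rfl
  have hzm : (⟨z, hz⟩ : L) ∈ maximalIdeal L := (mem_maximalIdeal_iff_inv_not_mem _).mpr hzS
  have e : Q.map (algebraMap A L) = (Ideal.span {p, q}).map (algebraMap A L) :=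
    congrArg (Ideal.map (algebraMap A L)) hQ
  rw [← IsLocalization.AtPrime.map_eq_maximalIdeal Q L, e, Ideal.map_span, Set.image_insert_eq,
    Set.image_singleton, Ideal.mem_span_pair] at hzm
  obtain ⟨a, c, hac⟩ := hzm
  refine ⟨a, a.2, c, c.2, ?_⟩
  have e' := congrArg (fun w : L => (w : K)) hac
  simp only [Subring.coe_add, Subring.coe_mul, halg] at e'
  exact e'.symm

/-! ## The new regular system of parameters after one quadratic transform -/

/-- **The exceptional curve through the new centre.** If `R₁` is the quadratic transform of the
two-dimensional regular local ring `R ⊆ K` along a valuation ring `O` dominating `R`, then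
`𝔪_{R₁} = (x, f)` for the chart element `x ∈ 𝔪_R` (a non-unit of `R`) and some `f`: with
`𝔪_R = (x, y)`, `R₁ = R[y/x]_Q` and the primes `Q` of `R[y/x]` over `xR[y/x] = 𝔪_R R[y/x]` are
`(x, f)` (Huneke–Swanson p. 264). [cite: HunekeSwanson2006, §14.2 (p. 264)] -/
theorem exists_maximalIdeal_eq_span_pair_of_step {O : ValuationSubring K} {R R₁ : Subring K}
    [IsRegularLocalRing R] [IsLocalRing R₁] (hdim : ringKrullDim R = 2)
    (hO : SubringDominates R O.toSubring) (h : IsQuadraticTransformAlong O R R₁) :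
    ∃ x f : R₁, (x : K) ∈ R ∧ (x : K)⁻¹ ∉ R ∧ maximalIdeal R₁ = Ideal.span {x, f} := by
  have hqt : IsQuadraticTransform R R₁ := h.isQuadraticTransform hO
  obtain ⟨_, x, hxm, hx0, _, hT, -, hdom⟩ := id hqt
  have hx2 : x ∉ maximalIdeal R ^ 2 := IsQuadraticTransform.chart_not_mem_sq hT hdom hx0
  obtain ⟨y, hm, -, -⟩ := exists_maximalIdeal_eq_span_pair_of_not_mem_sq hdim hxm hx2
  have hx0K : ((x : R) : K) ≠ 0 := fun e => hx0 (Subtype.ext e)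
  set w : K := ((y : R) : K) / ((x : R) : K) with hw
  set A : Subring K := (Algebra.adjoin R {w}).toSubring with hAdef
  have hA : blowupRing R (x : K) = A := blowupRing_eq_adjoin hm
  have hAle : A ≤ R₁ := hA ▸ hT
  have hRR₁ : R ≤ R₁ := hdom.1
  set Q : Ideal A := (maximalIdeal R₁).comap (Subring.inclusion hAle) with hQdef
  haveI hQ : Q.IsPrime := Ideal.comap_isPrime _ _
  have hR₁eq : R₁ = (LocalSubring.ofPrime A Q).toSubring :=
    hqt.eq_ofPrime_of_le hxm hx0 hA.le hAle
  -- `𝔪_R A ≤ Q`, so `Q = (x, f)`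
  have h𝔭Q : (maximalIdeal R).map (Subring.inclusion (subring_le_adjoin R w)) ≤ Q := by
    rw [Ideal.map_le_iff_le_comap]
    intro r hr
    rw [Ideal.mem_comap, hQdef, Ideal.mem_comap]
    exact (incl_mem_maximalIdeal_iff hdom r).mpr hr
  obtain ⟨f, hQf⟩ := exists_eq_span_pair_of_map_maximalIdeal_le hm hx0 rfl h𝔭Q
  have hxinvR : ((x : R) : K)⁻¹ ∉ R := fun h =>
    ((mem_maximalIdeal_iff_inv_not_mem x).mp hxm).elim hx0K (· h)
  have hxinv : ((x : R) : K)⁻¹ ∉ R₁ := fun h => hxinvR (hdom.2 _ x.2 h)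
  have hfQ : f ∈ Q := hQf ▸ Ideal.subset_span (by simp)
  have hfinv : (f : K) = 0 ∨ (f : K)⁻¹ ∉ R₁ := by
    have hf : Subring.inclusion hAle f ∈ maximalIdeal R₁ := hfQ
    exact (mem_maximalIdeal_iff_inv_not_mem _).mp hf
  refine ⟨⟨x, hRR₁ x.2⟩, ⟨f, hAle f.2⟩, x.2, hxinvR, ?_⟩
  refine maximalIdeal_eq_span_pair_of_forall (hRR₁ x.2) (hAle f.2) (Or.inr hxinv) hfinv
    fun z hz hzS => ?_
  rw [hR₁eq] at hz hzS ⊢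
  exact exists_eq_comb_of_ofPrime hQf hz hzS

/-- **The key step.** Let `R₁` be the quadratic transform of the two-dimensional regular local
ring `R ⊆ K` along a valuation ring `O` dominating `R`, `𝔪_R = (u, v)`, and `W ⊇ R₁` a
valuation ring of `K` with `w(u) > 0` and `w(v) = 0`. Then `v, u/v ∈ R₁` and
`𝔪_{R₁} = (v, u/v)`: `R₁` cannot lie in the chart `R[v/u]` (as `v/u ∉ W`), so
`R₁ = R[u/v]_Q` with `Q ∋ v, u/v`; and every element of `R[u/v]` is congruent modulo `u/v` to an
element of `R`, i.e. to a unit or to an element of `𝔪_R = (v · (u/v), v)`, whence `Q = (v, u/v)`.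
[cite: HunekeSwanson2006, §14.2 (p. 264)] -/
theorem key_step {O W : ValuationSubring K} {R R₁ : Subring K} [IsRegularLocalRing R]
    [IsLocalRing R₁] (hdim : ringKrullDim R = 2) (hO : SubringDominates R O.toSubring)
    (h : IsQuadraticTransformAlong O R R₁) {u v : R} (huv : maximalIdeal R = Ideal.span {u, v})
    (hR₁W : R₁ ≤ W.toSubring) (hu : W.valuation (u : K) < 1) (hv : ¬ W.valuation (v : K) < 1) :
    ∃ (hv₁ : ((v : R) : K) ∈ R₁) (ht₁ : ((u : R) : K) / ((v : R) : K) ∈ R₁),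
      maximalIdeal R₁ = Ideal.span {⟨(v : K), hv₁⟩, ⟨((u : R) : K) / ((v : R) : K), ht₁⟩} := by
  have hqt : IsQuadraticTransform R R₁ := h.isQuadraticTransform hO
  have hdom : SubringDominates R R₁ := hqt.dominates
  have hRR₁ : R ≤ R₁ := hdom.1
  have hRW : R ≤ W.toSubring := hRR₁.trans hR₁W
  have hvm : v ∈ maximalIdeal R := huv ▸ Ideal.subset_span (by simp)
  -- `u ≠ 0` (else `𝔪_R = (v)`), `v` is a unit of `W`, `u` is not
  have hu0 : u ≠ 0 := by
    rintro rfl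
    refine maximalIdeal_ne_span_singleton hdim v ?_
    rw [huv, Ideal.span_insert, Ideal.span_singleton_eq_bot.mpr rfl, bot_sup_eq]
  have hu0K : ((u : R) : K) ≠ 0 := fun e => hu0 (Subtype.ext e)
  have huinvW : ((u : R) : K)⁻¹ ∉ W := by
    rw [← ValuationSubring.mem_nonunits_iff, ValuationSubring.mem_nonunits_iff_or] at hu
    exact hu.elim (fun h _ => hu0K h) id
  have hvW1 : W.valuation (v : K) = 1 :=
    le_antisymm ((W.valuation_le_one_iff _).mpr (hRW v.2)) (not_lt.mp hv)
  have hv0K : ((v : R) : K) ≠ 0 := ne_zero_of_valuation_eq_one hvW1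
  have hv0 : v ≠ 0 := fun e => hv0K (by rw [e]; rfl)
  have hvinvW : ((v : R) : K)⁻¹ ∈ W := by
    rw [← W.valuation_le_one_iff, map_inv₀, hvW1, inv_one]
  -- the transform lies in the chart of `v`
  have hV : blowupRing R (v : K) ≤ R₁ := by
    rcases hqt.blowupRing_le_or huv with hU | hV
    · exfalso
      have hvu : ((v : R) : K) / u ∈ R₁ := hU (div_mem_blowupRing _ hvm)
      apply huinvW
      have e : ((u : R) : K)⁻¹ = (v : K) / u * ((v : R) : K)⁻¹ := by field_simp
      rw [e]
      exact W.mul_mem _ _ (hR₁W hvu) hvinvW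
    · exact hV
  -- `R[𝔪/v] = R[u/v] = A` and `R₁ = A_Q`
  have huv' : maximalIdeal R = Ideal.span {v, u} := by rw [huv, Set.pair_comm]
  set t : K := ((u : R) : K) / ((v : R) : K) with ht
  have hA : blowupRing R (v : K) = (Algebra.adjoin R {t}).toSubring := blowupRing_eq_adjoin huv'
  set A : Subring K := (Algebra.adjoin R {t}).toSubring with hAdef
  have hAle : A ≤ R₁ := hA ▸ hV
  have hRA : R ≤ A := subring_le_adjoin R t
  have htA : t ∈ A := Algebra.self_mem_adjoin_singleton R t
  have htR₁ : t ∈ R₁ := hAle htA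
  have hvR₁ : ((v : R) : K) ∈ R₁ := hRR₁ v.2
  have htinv : t⁻¹ ∉ R₁ := fun hti => huinvW (by
    have e : ((u : R) : K)⁻¹ = t⁻¹ * ((v : R) : K)⁻¹ := by rw [ht]; field_simp
    rw [e]
    exact W.mul_mem _ _ (hR₁W hti) hvinvW)
  have hvinv : ((v : R) : K)⁻¹ ∉ R₁ := fun hvi =>
    ((mem_maximalIdeal_iff_inv_not_mem v).mp hvm).elim hv0K (fun h' => h' (hdom.2 _ v.2 hvi))
  set Q : Ideal A := (maximalIdeal R₁).comap (Subring.inclusion hAle) with hQdef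
  haveI hQ : Q.IsPrime := Ideal.comap_isPrime _ _
  have hR₁eq : R₁ = (LocalSubring.ofPrime A Q).toSubring :=
    hqt.eq_ofPrime_of_le hvm hv0 hA.le hAle
  -- `Q = (v, t)`
  set v' : A := ⟨(v : K), hRA v.2⟩ with hv'
  set t' : A := ⟨t, htA⟩ with ht'
  have hv'Q : v' ∈ Q := by
    rw [hQdef, Ideal.mem_comap]
    exact (mem_maximalIdeal_iff_inv_not_mem _).mpr (Or.inr hvinv)
  have ht'Q : t' ∈ Q := by
    rw [hQdef, Ideal.mem_comap]
    exact (mem_maximalIdeal_iff_inv_not_mem _).mpr (Or.inr htinv)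
  have hQeq : Q = Ideal.span {v', t'} := by
    refine le_antisymm (fun a ha => ?_) (span_pair_le_of_mem hv'Q ht'Q)
    obtain ⟨F, hF⟩ := exists_aeval_eq_of_mem_adjoin a.2
    -- `a = t · F.divX (t) + F(0)`
    have hg : aeval t F.divX ∈ A := Polynomial.aeval_mem_adjoin_singleton R t
    set r : R := F.coeff 0 with hr
    have hdec : a = t' * ⟨_, hg⟩ + ⟨(r : K), hRA r.2⟩ := by
      apply Subtype.ext
      change (a : K) = t * aeval t F.divX + (r : K)
      rw [← hF]
      conv_lhs => rw [← Polynomial.X_mul_divX_add F]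
      rw [map_add, map_mul, aeval_X, aeval_C]
      rfl
    have hrQ : (⟨(r : K), hRA r.2⟩ : A) ∈ Q := by
      have h1 : a - t' * ⟨_, hg⟩ ∈ Q := Q.sub_mem ha (Q.mul_mem_right _ ht'Q)
      rwa [hdec, add_sub_cancel_left] at h1
    have hrm : r ∈ maximalIdeal R := by
      by_contra hru
      have hu' : IsUnit (⟨(r : K), hRA r.2⟩ : A) :=
        (IsLocalRing.notMem_maximalIdeal.mp hru).map (Subring.inclusion hRA)
      exact hQ.ne_top (Ideal.eq_top_of_isUnit_mem _ hrQ hu')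
    rw [huv, Ideal.mem_span_pair] at hrm
    obtain ⟨α, β, hαβ⟩ := hrm
    rw [hdec]
    refine Ideal.add_mem _ (Ideal.mul_mem_right _ _ (Ideal.subset_span (by simp))) ?_
    have e : (⟨(r : K), hRA r.2⟩ : A) =
        (⟨(α : K), hRA α.2⟩ * t' + ⟨(β : K), hRA β.2⟩) * v' := by
      apply Subtype.ext
      change ((r : R) : K) = ((α : K) * t + (β : K)) * (v : K)
      rw [← hαβ, Subring.coe_add, Subring.coe_mul, Subring.coe_mul, ht]
      field_simp
    rw [e]
    exact Ideal.mul_mem_left _ _ (Ideal.subset_span (by simp))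
  -- conclusion: `𝔪_{R₁} = Q R₁ = (v, t)`
  refine ⟨hvR₁, htR₁, ?_⟩
  refine maximalIdeal_eq_span_pair_of_forall hvR₁ htR₁ (Or.inr hvinv) (Or.inr htinv)
    fun z hz hzS => ?_
  rw [hR₁eq] at hz hzS ⊢
  exact exists_eq_comb_of_ofPrime hQeq hz hzS

/-! ## Members of a regular system of parameters avoid `𝔪²` -/

/-- In a two-dimensional regular local ring, a member `x` of a two-element generating set
`𝔪 = (x, f)` of the maximal ideal does not lie in `𝔪²`: otherwise `𝔪 = (f) + 𝔪²`, so `𝔪 = (f)`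
by Nakayama, and `𝔪` would be principal. [folklore] -/
theorem not_mem_sq_of_span_pair {S : Type} [CommRing S] [IsRegularLocalRing S]
    (hdim : ringKrullDim S = 2) {x f : S} (h : maximalIdeal S = Ideal.span {x, f}) :
    x ∉ maximalIdeal S ^ 2 := by
  intro hx2
  apply maximalIdeal_ne_span_singleton hdim f
  have hf : f ∈ maximalIdeal S := h ▸ Ideal.subset_span (by simp)
  refine le_antisymm ?_ ((Ideal.span_singleton_le_iff_mem _).mpr hf)
  refine Submodule.le_of_le_smul_of_le_jacobson_bot (IsNoetherian.noetherian _)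
    (maximalIdeal_le_jacobson _) ?_
  conv_lhs => rw [h]
  rw [Ideal.span_le]
  rintro _ (rfl | rfl)
  · refine Submodule.mem_sup_right ?_
    rw [Ideal.smul_eq_mul, ← pow_two]
    exact hx2
  · exact Submodule.mem_sup_left (Ideal.mem_span_singleton_self _)

end Summit.ResolutionOfSingularities.ResolutionOfSingularities.Theorems.PfaffLine.CurveMono

namespace Summit.ResolutionOfSingularities.ResolutionOfSingularities.Theorems.PfaffLine

/-- **Registered sub-goal `curveMono_key_step`** (universe `0`, for `--supports` registration):
the key step `𝔪_{R₁} = (v, u/v)` of the normal-crossings bookkeeping along one quadratic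
transform. [folklore] -/
theorem curveMono_key_step : ∀ {K : Type} [Field K] {O W : ValuationSubring K} {R R₁ : Subring K} [IsRegularLocalRing R] [IsLocalRing R₁], ringKrullDim R = 2 → Literature.AlgebraicGeometry.Resolution.SubringDominates R O.toSubring → Literature.AlgebraicGeometry.Resolution.IsQuadraticTransformAlong O R R₁ → ∀ {u v : R}, IsLocalRing.maximalIdeal R = Ideal.span {u, v} → R₁ ≤ W.toSubring → W.valuation (u : K) < 1 → ¬ W.valuation (v : K) < 1 → ∃ (hv₁ : ((v : R) : K) ∈ R₁) (ht₁ : ((u : R) : K) / ((v : R) : K) ∈ R₁), IsLocalRing.maximalIdeal R₁ = Ideal.span {(⟨(v : K), hv₁⟩ : R₁), ⟨((u : R) : K) / ((v : R) : K), ht₁⟩} := by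
  intro K _ O W R R₁ _ _ hdim hO h u v huv hR₁W hu hv
  exact CurveMono.key_step hdim hO h huv hR₁W hu hv

end Summit.ResolutionOfSingularities.ResolutionOfSingularities.Theorems.PfaffLine
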